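import Summits.KontsevichZagierPeriods.KontsevichZagierPeriods.Theses.IsogenyCertificates
import Summits.KontsevichZagierPeriods.KontsevichZagierPeriods.Theorems.XMapPeriodTransfer.Negative.LoadBearingDatum

/-!
# `XMapPeriodTransfer` (stmt-KontsevichZagierPeriods-10665), line `saturated-sign-cells` — stub `stub_cellEnds`

End limits of the real x-map `R = f/g` of a COPRIME x-rational isogeny datum `(f, g, c)` between
`y² = P(x) = x³ + Ax + B` and `y² = P'(x) = x³ + A'x + B'`, i.e. `W = f'g − fg' ≠ 0` in `ℚ[X]` and
`c²·g·(f³ + A'fg² + B'g³) = P·W²` (registered stub `stub_cellEnds` of the line's skeleton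
`Cruxes/XMapPeriodTransfer/Lines/saturated-sign-cells.lean`):

* at every real `p` with `P(p)·W(p) = 0`: if `g(p) ≠ 0` then `R` is continuous at `p` and `R(p)` is
  a root of `P'` — evaluating the identity at `p` gives `c²·g(p)·(f³ + A'fg² + B'g³)(p) =
  P(p)·W(p)² = 0`, and `c ≠ 0` (`XMapPeriodTransferDatum.g_ne_zero_and_c_ne_zero`); if `g(p) = 0`
  then `f(p) ≠ 0` by coprimality, `g ≠ 0` on a punctured neighbourhood of `p` (finitely many real
  roots), and `|R| = |f|/|g| → ∞` there;
* at `+∞`: if `deg f > deg g` then `|R| → ∞`; if `deg f ≤ deg g = n` (`n ≥ 1` since `W ≠ 0`) then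
  `R → ℓ = f_n / g_n` and `ℓ` is a root of `P'`: the `X^{2n-1}`-coefficients `n f_n g_n` of `f'g`
  and `fg'` cancel, so `deg W ≤ 2n − 2`, `deg (P·W²) ≤ 4n − 1`, and the `X^{4n}`-coefficient of the
  identity reads `c²·g_n·(f_n³ + A' f_n g_n² + B' g_n³) = 0`.

No definitions are introduced; everything is Mathlib (`Polynomial.div_tendsto_atTop_*`,
`Polynomial.abs_div_tendsto_atTop_atTop_of_degree_gt`, `nhdsNE_le_cofinite`,
`Filter.Tendsto.inv_tendsto_nhdsGT_zero`) plus `XMapPeriodTransferDatum.g_ne_zero_and_c_ne_zero`.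

References: M. Kontsevich, D. Zagier, *Periods* (2001), §1.2 (the calculus this line serves);
the statements here are elementary real analysis of rational functions (folklore).
-/

noncomputable section

open Set Filter MeasureTheory Polynomial Topology
open Literature.NumberTheory.Transcendental

namespace Summit.KontsevichZagierPeriods.IsogenyCertificates.XMapPeriodTransferCells

/-! ### Algebra: degree of the Wronskian and the top coefficient of the identity -/

/-- If `deg f ≤ deg g` and the Wronskian `f'g − fg'` is nonzero, then `deg g ≠ 0` (two constants
have zero Wronskian). [folklore] -/
theorem cellEnds_natDegree_ne_zero {f g : ℚ[X]} (hW : derivative f * g - f * derivative g ≠ 0)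
    (hfg : f.natDegree ≤ g.natDegree) : g.natDegree ≠ 0 := by
  intro hg
  have hf : f.natDegree = 0 := Nat.le_zero.mp (hg ▸ hfg)
  exact hW (by rw [derivative_of_natDegree_zero hf, derivative_of_natDegree_zero hg, zero_mul,
    mul_zero, sub_zero])

/-- For `deg f, deg g ≤ m + 1` the Wronskian `f'g − fg'` has degree `≤ 2m`: its
`X^{2m+1}`-coefficient is `(m+1) f_{m+1} g_{m+1} − f_{m+1} (m+1) g_{m+1} = 0`. [folklore] -/
theorem cellEnds_natDegree_wronskian_le {f g : ℚ[X]} {m : ℕ} (hf : f.natDegree ≤ m + 1)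
    (hg : g.natDegree ≤ m + 1) :
    (derivative f * g - f * derivative g).natDegree ≤ 2 * m := by
  have hf' : (derivative f).natDegree ≤ m := (natDegree_derivative_le f).trans (by omega)
  have hg' : (derivative g).natDegree ≤ m := (natDegree_derivative_le g).trans (by omega)
  have h1 : (derivative f * g).natDegree ≤ 2 * m + 1 :=
    natDegree_mul_le.trans ((add_le_add hf' hg).trans (by omega))
  have h2 : (f * derivative g).natDegree ≤ 2 * m + 1 :=
    natDegree_mul_le.trans ((add_le_add hf hg').trans (by omega))
  have h3 : (derivative f * g - f * derivative g).natDegree ≤ 2 * m + 1 :=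
    (natDegree_sub_le _ _).trans (max_le h1 h2)
  have h4 : (derivative f * g - f * derivative g).coeff (2 * m + 1) = 0 := by
    have e1 : (derivative f * g).coeff (2 * m + 1) = (derivative f).coeff m * g.coeff (m + 1) := by
      rw [show 2 * m + 1 = m + (m + 1) by ring]
      exact coeff_mul_add_eq_of_natDegree_le hf' hg
    have e2 : (f * derivative g).coeff (2 * m + 1) = f.coeff (m + 1) * (derivative g).coeff m := by
      rw [show 2 * m + 1 = (m + 1) + m by ring]
      exact coeff_mul_add_eq_of_natDegree_le hf hg'
    rw [coeff_sub, e1, e2, coeff_derivative, coeff_derivative]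
    ring
  have h5 := natDegree_le_pred h3 h4
  omega

/-- **Top coefficient of the certificate identity.** If `deg f, deg g ≤ m + 1` then
`deg (P·W²) ≤ 4m + 3`, so comparing `X^{4m+4}`-coefficients in
`c²·g·(f³ + A'fg² + B'g³) = P·W²` gives
`c²·g_{m+1}·(f_{m+1}³ + A' f_{m+1} g_{m+1}² + B' g_{m+1}³) = 0`. [folklore] -/
theorem cellEnds_coeff_top {A B A' B' : ℤ} {f g : ℚ[X]} {c : ℚ} {m : ℕ}
    (hI : C (c ^ 2) * g * (f ^ 3 + C (A' : ℚ) * f * g ^ 2 + C (B' : ℚ) * g ^ 3) =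
        (X ^ 3 + C (A : ℚ) * X + C (B : ℚ)) * (derivative f * g - f * derivative g) ^ 2)
    (hf : f.natDegree ≤ m + 1) (hg : g.natDegree ≤ m + 1) :
    c ^ 2 * g.coeff (m + 1) * (f.coeff (m + 1) ^ 3 +
      (A' : ℚ) * f.coeff (m + 1) * g.coeff (m + 1) ^ 2 + (B' : ℚ) * g.coeff (m + 1) ^ 3) = 0 := by
  have hW := cellEnds_natDegree_wronskian_le hf hg
  have hP : (X ^ 3 + C (A : ℚ) * X + C (B : ℚ) : ℚ[X]).natDegree ≤ 3 := by compute_degree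
  have hR : ((X ^ 3 + C (A : ℚ) * X + C (B : ℚ)) *
      (derivative f * g - f * derivative g) ^ 2).natDegree < (m + 1) + 3 * (m + 1) := by
    refine (natDegree_mul_le.trans (add_le_add hP (natDegree_pow_le_of_le 2 hW))).trans_lt ?_
    omega
  have h0 := coeff_eq_zero_of_natDegree_lt hR
  rw [← hI] at h0
  have h1 : (C (c ^ 2) * g).natDegree ≤ m + 1 := (natDegree_C_mul_le _ _).trans hg
  have hQ : (f ^ 3 + C (A' : ℚ) * f * g ^ 2 + C (B' : ℚ) * g ^ 3).natDegree ≤ 3 * (m + 1) := by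
    refine natDegree_add_le_of_degree_le (natDegree_add_le_of_degree_le
      (natDegree_pow_le_of_le 3 hf) (natDegree_mul_le.trans ?_))
      ((natDegree_C_mul_le _ _).trans (natDegree_pow_le_of_le 3 hg))
    have := add_le_add ((natDegree_C_mul_le (A' : ℚ) f).trans hf) (natDegree_pow_le_of_le 2 hg)
    omega
  have e1 : (f ^ 3).coeff (3 * (m + 1)) = f.coeff (m + 1) ^ 3 := coeff_pow_of_natDegree_le hf
  have e2 : (C (A' : ℚ) * f * g ^ 2).coeff (3 * (m + 1)) =
      (A' : ℚ) * f.coeff (m + 1) * g.coeff (m + 1) ^ 2 := by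
    rw [show 3 * (m + 1) = (m + 1) + 2 * (m + 1) by ring, coeff_mul_add_eq_of_natDegree_le
      ((natDegree_C_mul_le _ _).trans hf) (natDegree_pow_le_of_le 2 hg), coeff_C_mul,
      coeff_pow_of_natDegree_le hg]
  have e3 : (C (B' : ℚ) * g ^ 3).coeff (3 * (m + 1)) = (B' : ℚ) * g.coeff (m + 1) ^ 3 := by
    rw [coeff_C_mul, coeff_pow_of_natDegree_le hg]
  rw [coeff_mul_add_eq_of_natDegree_le h1 hQ, coeff_C_mul, coeff_add, coeff_add, e1, e2, e3] at h0
  exact h0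

/-! ### Analysis at a finite point -/

/-- A nonzero rational polynomial is nonzero on a punctured neighbourhood of every real point (it
has finitely many real roots and `𝓝[≠] p ≤ cofinite`). [folklore] -/
theorem cellEnds_eventually_ne_zero {g : ℚ[X]} (hg : g ≠ 0) (p : ℝ) :
    ∀ᶠ x in 𝓝[≠] p, aeval x g ≠ 0 := by
  have hgR : g.map (algebraMap ℚ ℝ) ≠ 0 := Polynomial.map_ne_zero hg
  filter_upwards [nhdsNE_le_cofinite p (finite_setOf_isRoot hgR).compl_mem_cofinite] with x hx
  simpa [IsRoot] using hx

/-- **Pole.** If `g(p) = 0 ≠ f(p)` (and `g ≠ 0`) then `|f/g| → ∞` on the punctured neighbourhood of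
`p`: the numerator tends to `|f(p)| > 0`, the denominator to `0` through positive values. [folklore] -/
theorem cellEnds_tendsto_abs_div_atTop {f g : ℚ[X]} (hg : g ≠ 0) {p : ℝ} (hF : aeval p f ≠ 0)
    (hG : aeval p g = 0) :
    Tendsto (fun x : ℝ => |aeval x f / aeval x g|) (𝓝[≠] p) atTop := by
  have h1 : Tendsto (fun x : ℝ => |aeval x g|) (𝓝[≠] p) (𝓝[>] 0) := by
    refine tendsto_nhdsWithin_iff.mpr ⟨?_, ?_⟩
    · have h : Tendsto (fun x : ℝ => |aeval x g|) (𝓝 p) (𝓝 |aeval p g|) :=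
        ((Polynomial.continuous_aeval g).tendsto p).abs
      rw [hG, abs_zero] at h
      exact h.mono_left nhdsWithin_le_nhds
    · filter_upwards [cellEnds_eventually_ne_zero hg p] with x hx using abs_pos.mpr hx
  have h2 : Tendsto (fun x : ℝ => |aeval x f|) (𝓝[≠] p) (𝓝 |aeval p f|) :=
    ((Polynomial.continuous_aeval f).tendsto p).abs.mono_left nhdsWithin_le_nhds
  have h3 := h2.pos_mul_atTop (abs_pos.mpr hF) h1.inv_tendsto_nhdsGT_zero
  refine h3.congr fun x => ?_
  simp [div_eq_mul_inv]

/-- **Regular end point.** If `P(p)·W(p) = 0` and `g(p) ≠ 0` then `R(p) = f(p)/g(p)` is a root of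
`P'`: evaluating the identity at `p` gives `c²·g(p)·(f³ + A'fg² + B'g³)(p) = P(p)·W(p)² = 0` with
`c ≠ 0`, `g(p) ≠ 0`; divide by `g(p)³`. [folklore] -/
theorem cellEnds_root_of_regular {A B A' B' : ℤ} {f g : ℚ[X]} {c : ℚ} (hc : c ≠ 0)
    (hI : C (c ^ 2) * g * (f ^ 3 + C (A' : ℚ) * f * g ^ 2 + C (B' : ℚ) * g ^ 3) =
        (X ^ 3 + C (A : ℚ) * X + C (B : ℚ)) * (derivative f * g - f * derivative g) ^ 2)
    {p : ℝ} (hp : (p ^ 3 + (A : ℝ) * p + (B : ℝ)) * aeval p (derivative f * g - f * derivative g) = 0)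
    (hG : aeval p g ≠ 0) :
    (aeval p f / aeval p g) ^ 3 + (A' : ℝ) * (aeval p f / aeval p g) + (B' : ℝ) = 0 := by
  have hev := congrArg (aeval p) hI
  simp only [map_mul, map_pow, map_add, aeval_C, aeval_X, eq_ratCast, Rat.cast_intCast] at hev
  have hzero : (c : ℝ) ^ 2 * aeval p g *
      (aeval p f ^ 3 + (A' : ℝ) * aeval p f * aeval p g ^ 2 + (B' : ℝ) * aeval p g ^ 3) = 0 := by
    linear_combination hev + aeval p (derivative f * g - f * derivative g) * hp
  have hc' : (c : ℝ) ^ 2 ≠ 0 := pow_ne_zero _ (Rat.cast_ne_zero.mpr hc)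
  have hQ : aeval p f ^ 3 + (A' : ℝ) * aeval p f * aeval p g ^ 2 + (B' : ℝ) * aeval p g ^ 3 = 0 :=
    (mul_eq_zero.mp hzero).resolve_left (mul_ne_zero hc' hG)
  field_simp
  linear_combination hQ

/-! ### The registered stub -/

/-- **Registered stub `stub_cellEnds`** (E2, end limits) of the line `saturated-sign-cells`. For a
COPRIME datum: at every real `p` with `P(p)·W(p) = 0` the x-map `R = f/g` has a punctured limit
which is a root of `P'`, or `|R| → ∞`; and at `+∞` the same alternative holds (limit `f_n/g_n` when
`deg f ≤ deg g = n`, by the top-coefficient identity `cellEnds_coeff_top`). [folklore] -/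
theorem stub_cellEnds : ∀ (A B A' B' : ℤ) (f g : ℚ[X]) (c : ℚ),
    derivative f * g - f * derivative g ≠ 0 →
    C (c ^ 2) * g * (f ^ 3 + C (A' : ℚ) * f * g ^ 2 + C (B' : ℚ) * g ^ 3) =
      (X ^ 3 + C (A : ℚ) * X + C (B : ℚ)) * (derivative f * g - f * derivative g) ^ 2 →
    IsCoprime f g →
    ∀ (R W : ℝ → ℝ), R = (fun y => aeval y f / aeval y g) →
      W = (fun y => aeval y (derivative f * g - f * derivative g)) →
    (∀ p : ℝ, (p ^ 3 + (A : ℝ) * p + (B : ℝ)) * W p = 0 →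
        (∃ ℓ : ℝ, ℓ ^ 3 + (A' : ℝ) * ℓ + (B' : ℝ) = 0 ∧ Tendsto R (𝓝[≠] p) (𝓝 ℓ)) ∨
          Tendsto (fun x => |R x|) (𝓝[≠] p) atTop) ∧
    ((∃ ℓ : ℝ, ℓ ^ 3 + (A' : ℝ) * ℓ + (B' : ℝ) = 0 ∧ Tendsto R atTop (𝓝 ℓ)) ∨
      Tendsto (fun x => |R x|) atTop atTop) := by
  intro A B A' B' f g c hW hI hcop R W hR hWd
  obtain ⟨hg0, hc0⟩ := XMapPeriodTransferDatum.g_ne_zero_and_c_ne_zero hW hI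
  subst hR hWd
  refine ⟨fun p hp => ?_, ?_⟩
  · by_cases hG : aeval p g = 0
    · right
      have hF : aeval p f ≠ 0 := by
        obtain ⟨u, v, huv⟩ := hcop
        have h := congrArg (aeval p) huv
        simp only [map_add, map_mul, map_one, hG, mul_zero, add_zero] at h
        intro hF
        rw [hF, mul_zero] at h
        exact zero_ne_one h
      exact cellEnds_tendsto_abs_div_atTop hg0 hF hG
    · left
      exact ⟨aeval p f / aeval p g, cellEnds_root_of_regular hc0 hI hp hG,
        (((Polynomial.continuous_aeval f).continuousAt.div₀
          (Polynomial.continuous_aeval g).continuousAt hG).tendsto).mono_left nhdsWithin_le_nhds⟩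
  · have hgR : g.map (algebraMap ℚ ℝ) ≠ 0 := Polynomial.map_ne_zero hg0
    rcases lt_or_ge g.degree f.degree with hlt | hle
    · right
      have h := (f.map (algebraMap ℚ ℝ)).abs_div_tendsto_atTop_atTop_of_degree_gt
        (g.map (algebraMap ℚ ℝ)) (by rwa [degree_map, degree_map]) hgR
      simpa using h
    · left
      have hle : f.degree ≤ g.degree := hle
      have hfn : f.natDegree ≤ g.natDegree := natDegree_le_natDegree hle
      obtain ⟨m, hm⟩ : ∃ m, g.natDegree = m + 1 :=
        Nat.exists_eq_succ_of_ne_zero (cellEnds_natDegree_ne_zero hW hfn)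
      have hb : g.coeff (m + 1) ≠ 0 := by
        rw [← hm, coeff_natDegree]; exact leadingCoeff_ne_zero.mpr hg0
      have key : f.coeff (m + 1) ^ 3 + (A' : ℚ) * f.coeff (m + 1) * g.coeff (m + 1) ^ 2 +
          (B' : ℚ) * g.coeff (m + 1) ^ 3 = 0 :=
        (mul_eq_zero.mp (cellEnds_coeff_top hI (hfn.trans hm.le) hm.le)).resolve_left
          (mul_ne_zero (pow_ne_zero _ hc0) hb)
      refine ⟨(f.coeff (m + 1) : ℝ) / (g.coeff (m + 1) : ℝ), ?_, ?_⟩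
      · have hbR : ((g.coeff (m + 1) : ℚ) : ℝ) ≠ 0 := Rat.cast_ne_zero.mpr hb
        have keyR : ((f.coeff (m + 1) : ℚ) : ℝ) ^ 3 +
            (A' : ℝ) * (f.coeff (m + 1) : ℝ) * (g.coeff (m + 1) : ℝ) ^ 2 +
            (B' : ℝ) * ((g.coeff (m + 1) : ℚ) : ℝ) ^ 3 = 0 := by
          exact_mod_cast key
        field_simp
        linear_combination keyR
      · rcases hle.lt_or_eq with hlt | heq
        · have hdeg : g.degree = ((m + 1 : ℕ) : WithBot ℕ) := by rw [degree_eq_natDegree hg0, hm]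
          have ha : f.coeff (m + 1) = 0 := coeff_eq_zero_of_degree_lt (hlt.trans_eq hdeg)
          have h := (f.map (algebraMap ℚ ℝ)).div_tendsto_atTop_zero_of_degree_lt
            (g.map (algebraMap ℚ ℝ)) (by rwa [degree_map, degree_map])
          rw [ha, Rat.cast_zero, zero_div]
          simpa using h
        · have h := (f.map (algebraMap ℚ ℝ)).div_tendsto_atTop_leadingCoeff_div_of_degree_eq
            (g.map (algebraMap ℚ ℝ)) (by rw [degree_map, degree_map, heq])
          have hfn' : f.natDegree = m + 1 := (natDegree_eq_of_degree_eq heq).trans hm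
          rw [leadingCoeff_map, leadingCoeff_map, ← coeff_natDegree, ← coeff_natDegree, hfn', hm,
            eq_ratCast, eq_ratCast] at h
          simpa using h

end Summit.KontsevichZagierPeriods.IsogenyCertificates.XMapPeriodTransferCells

end
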